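import Summits.Langlands.Langlands.Theorems.SqrtFiveQuarticCoversRank0FifteenTwist75
import Literature.NumberTheory.EllipticCurves.ComplexMultiplicationBurungaleFlachFiniteProofs
import Literature.NumberTheory.EllipticCurves.VariableChangePointsMap
import HarnessLib

/-!
# Route `Langlands/SqrtFiveQuarticCovers` — the isogeny class `15a` has rank `0` over `ℚ(√5)`:
# `X₀(15)` has finitely many points over every quadratic field containing `√5`

Cell lg-quartmod (F-L1), seat eng-6 g4 (lead ruling 2026-08-29T00:12:44Z; helper of stmt-Langlands-23415),
companion of `…Rank0FifteenTwist75.lean`.  MAIN THEOREM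

* `finite_point_X0_15_of_sq_eq_five (K) (hK : finrank ℚ K = 2) (hr : r ^ 2 = 5) :`
  `Finite (⟨1, 1, 1, -10, -10⟩ : WeierstrassCurve K).toAffine.Point`

— for every quadratic field `K` and `r ∈ K` with `r² = 5` (so `K = ℚ(√5)`), the curve
`X₀(15) = 15A1 : y² + xy + y = x³ + x² − 10x − 10` has finitely many `K`-points; equivalently the
isogeny class `15a` (which contains FLS's `D₁ = 15a8` of sheet 4.4/4.8 and `15a3`, `15a1` of the
sheet-4.2/4.6 lineages) has Mordell–Weil RANK `0` over `k = ℚ(√5)`.  This is the rank half of the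
NAMED rank-`0` input of the cell's lineage documents for rows 1 and 6 of the NAMED-INPUT TABLE
(«rank `0` of `15a` / `75b` over `ℚ(√5)`: exact `L`-values `L(15a,1)·L(15a⊗χ₅,1) ≠ 0` — certnum
RELEASES l.123 — plus Kolyvagin–Logachev, or `mwrank`»), now a kernel theorem; the torsion halves
(`D₁(k) ≅ ℤ/8`, …) remain certnum TORE certificates, and the factor `75c` (`75c ⊗ χ₅ = 75a`) of
row 1 is not touched.

PROOF (assembly of PROVED tree material, no new mathematics):
1. `Curve15A1.finite_point : Finite (15A1)(ℚ)` (complete `2`-descent, `Curve15A1Descent.lean`);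
2. `Twist75.finite_point : Finite (E₇₅)(ℚ)` for `E₇₅ = ⟨0, 25, 0, -3800, -78000⟩` (module 1 of this
   item), and `E₇₅ = (1/2, 0, 0, 0) • (15A1).quadraticTwist 5` (`smul_quadraticTwist_five`, by `ext`),
   so `Finite ((15A1).quadraticTwist 5)(ℚ)` through `VariableChange.pointEquiv`;
3. `WeierstrassCurve.finite_point_baseChange_of_finite_of_finite_quadraticTwist` (Silverman *AEC*
   Exercise 10.16 in finiteness form, `ComplexMultiplicationBurungaleFlachFiniteProofs.lean`): for
   `K = ℚ(θ)`, `θ² = c`, `θ ∉ ℚ`, `[K:ℚ] = 2`, `E(ℚ)` and `E^{(c)}(ℚ)` finite ⇒ `E(K)` finite — with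
   `θ = r`, `c = 5` (`r ∉ ℚ` as `5` is not a rational square, `Curve15A1.five_ne_sq`);
4. `(15A1).baseChange K = ⟨1, 1, 1, -10, -10⟩` over `K` (`baseChange_eq`).

HONEST STATUS: unconditional kernel theorem about the `K`-points of ONE explicit elliptic curve over
the quadratic fields `K ∋ √5`; rank `0` is not a BSD statement and not a modularity statement; it
closes no binder of the route's Record (it converts a named rank-`0` input INSIDE lineage documents of
rows 1·6 into a kernel theorem).  Nothing here proves modularity of a new class of elliptic curves.
References: [SilvermanAEC2009] X.1.4/X.1.5, VIII.6.7, Exercise 10.16; [CremonaAlgorithms1997] Table 1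
(`N = 15`, `N = 75`); [FreitasLeHungSiksek2015] §5.3 (the curve `D₁`, p. 26).
-/

noncomputable section

open scoped Classical

set_option linter.dupNamespace false -- project-wide option; `Summit.Langlands.Langlands` is the mandated namespace

namespace Summit.Langlands.Langlands.Theorems.SqrtFiveQuarticCovers

namespace Rank0Fifteen

open _root_.WeierstrassCurve Literature.NumberTheory.EllipticCurves

/-- `X₀(15) = 15A1 = [1, 1, 1, -10, -10]` is an elliptic curve: `Δ = 50625 = 3⁴·5⁴ ≠ 0`.
[cite: CremonaAlgorithms1997, Table 1, N = 15, curve A1] -/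
theorem isElliptic_X0_15 : (⟨1, 1, 1, -10, -10⟩ : WeierstrassCurve ℚ).IsElliptic :=
  ⟨by
    rw [show (⟨1, 1, 1, -10, -10⟩ : WeierstrassCurve ℚ).Δ = 50625 by
      norm_num [WeierstrassCurve.Δ, b₂, b₄, b₆, b₈]]
    norm_num⟩

/-- **The twist of `X₀(15)` by `5` is `E₇₅` up to the rescaling `u = 1/2`**:
`(1/2, 0, 0, 0) • (15A1).quadraticTwist 5 = ⟨0, 25, 0, -3800, -78000⟩` (the tree's `quadraticTwist 5`
of `[1,1,1,-10,-10]` is `⟨0, 25/4, 0, -475/2, -4875/4⟩`; `b₂ = 5`, `b₄ = -19`, `b₆ = -39`). [folklore] -/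
theorem smul_quadraticTwist_five :
    (⟨⟨(1 / 2 : ℚ), 2, by norm_num, by norm_num⟩, 0, 0, 0⟩ : VariableChange ℚ) •
        (⟨1, 1, 1, -10, -10⟩ : WeierstrassCurve ℚ).quadraticTwist 5 =
      (⟨0, 25, 0, -3800, -78000⟩ : WeierstrassCurve ℚ) := by
  ext
  · simp [variableChange_a₁]
  · simp only [variableChange_a₂, quadraticTwist_a₁, quadraticTwist_a₂, b₂]
    norm_num
  · simp [variableChange_a₃]
  · simp only [variableChange_a₄, quadraticTwist_a₁, quadraticTwist_a₂, quadraticTwist_a₃,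
      quadraticTwist_a₄, b₂, b₄]
    norm_num
  · simp only [variableChange_a₆, quadraticTwist_a₁, quadraticTwist_a₂, quadraticTwist_a₃,
      quadraticTwist_a₄, quadraticTwist_a₆, b₂, b₄, b₆]
    norm_num

/-- **The quadratic twist of `X₀(15)` by `5` has finitely many rational points** (rank `0` of
Cremona's class `75b`): transport of `Twist75.finite_point` along the change of variables
`smul_quadraticTwist_five` (`VariableChange.pointEquiv`). [cite: CremonaAlgorithms1997, Table 1, N = 75] -/
theorem finite_point_quadraticTwist_five :
    Finite ((⟨1, 1, 1, -10, -10⟩ : WeierstrassCurve ℚ).quadraticTwist 5).toAffine.Point := by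
  have e := (VariableChange.pointEquiv ((⟨1, 1, 1, -10, -10⟩ : WeierstrassCurve ℚ).quadraticTwist 5)
    (⟨⟨(1 / 2 : ℚ), 2, by norm_num, by norm_num⟩, 0, 0, 0⟩ : VariableChange ℚ)).trans
    (Affine.Point.congrEquiv smul_quadraticTwist_five)
  haveI := Twist75.finite_point
  exact Finite.of_equiv _ e.toEquiv.symm

/-- Over any `ℚ`-algebra `K` that is a field, the base change of `[1, 1, 1, -10, -10]` is the
Weierstrass equation `[1, 1, 1, -10, -10]` over `K`. [folklore] -/
theorem baseChange_eq (K : Type) [Field K] [CharZero K] :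
    (⟨1, 1, 1, -10, -10⟩ : WeierstrassCurve ℚ).baseChange K = (⟨1, 1, 1, -10, -10⟩ : WeierstrassCurve K) := by
  ext <;> simp [baseChange, map]

/-- `√5 ∉ ℚ`: an element `r` of a field of characteristic `0` with `r² = 5` is not in the image of
`ℚ` (`5` is not a rational square, `Curve15A1.five_ne_sq`). [folklore] -/
theorem sqrt_five_not_mem_range (K : Type) [Field K] [CharZero K] {r : K} (hr : r ^ 2 = 5) :
    r ∉ Set.range (algebraMap ℚ K) := by
  rintro ⟨q, hq⟩
  apply Curve15A1.five_ne_sq q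
  have h1 : ((q ^ 2 : ℚ) : K) = ((5 : ℚ) : K) := by
    rw [Rat.cast_pow, Rat.cast_ofNat, ← hr, ← hq, eq_ratCast]
  exact (Rat.cast_injective h1).symm

/-- **The isogeny class `15a` has rank `0` over `ℚ(√5)`: `X₀(15)(K)` is finite for every quadratic
field `K ∋ √5`.**  For a field `K` with `[K:ℚ] = 2` and `r ∈ K`, `r² = 5`, the curve
`15A1 : y² + xy + y = x³ + x² − 10x − 10` has finitely many `K`-rational points.  Assembly:
`Curve15A1.finite_point` (rank `0` over `ℚ`, complete `2`-descent), `finite_point_quadraticTwist_five`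
(rank `0` of the `5`-twist, module `…Rank0FifteenTwist75`), and the quadratic finiteness transfer
`finite_point_baseChange_of_finite_of_finite_quadraticTwist` (Silverman *AEC* Exercise 10.16) with
`θ = r`, `c = 5`.  The NAMED input «rank `15a(ℚ(√5)) = 0`» of the cell's row-1/row-6 lineages
(LV0 RELEASES l.123 + Kolyvagin–Logachev) as a kernel theorem; torsion (`D₁(k) ≅ ℤ/8`) stays a
certnum TORE certificate. [cite: SilvermanAEC2009, Exercise 10.16 and Thm. VIII.6.7; CremonaAlgorithms1997, Table 1, N = 15 and N = 75] -/
theorem finite_point_X0_15_of_sq_eq_five (K : Type) [Field K] [CharZero K]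
    (hK : Module.finrank ℚ K = 2) {r : K} (hr : r ^ 2 = 5) :
    Finite (⟨1, 1, 1, -10, -10⟩ : WeierstrassCurve K).toAffine.Point := by
  haveI := isElliptic_X0_15
  have hc : r ^ 2 = algebraMap ℚ K 5 := by rw [hr, map_ofNat]
  have hfin := (⟨1, 1, 1, -10, -10⟩ : WeierstrassCurve ℚ).finite_point_baseChange_of_finite_of_finite_quadraticTwist
    hK (sqrt_five_not_mem_range K hr) hc Curve15A1.finite_point finite_point_quadraticTwist_five
  rw [baseChange_eq K] at hfin
  exact hfin

end Rank0Fifteen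

end Summit.Langlands.Langlands.Theorems.SqrtFiveQuarticCovers

end
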